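import Summits.CriticalPhenomena.PercolationContinuityZ3.Theorems.PercNearOneGluingNoHeavyLowerTailSunflowerBipartiteGrain

/-!
# `NoHeavyLowerTail` (crux stmt-CriticalPhenomena-4575), abstract sunflower cubic: **BAL-bip — EVERY BIPARTITE GRAPH CORE HAS THE
# COVER PROPERTY AT EVERY p** (memo FINDING-PAR-prove1-g46 THEOREM 3); hence graded safety, safety, and `Safe(B ⊔ Γ')`

Support file (seat `prim-ineq-prove-1` gen 46; `--supports stmt-CriticalPhenomena-4575`).  Continues `…SunflowerBipartiteGrain`.
The MÖBIUS CERTIFICATE: the weight of the clause `C` is `∏ tR φ S` over the nonempty atom sets `S` with joint neighbourhood `C ∩ R`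
(`weight`), where `φ B = P(ω ∩ L = B) · ∏_{r ∈ nb B} (1 - p r)`.  By `famIn_clauses_eq_G` and THEOREM 2 (`Grain.G_le_FR'`, applied with
masses `(1-ε)·mass` and `ε → 0`) these weights satisfy the hypotheses of `SafeCalc.cover_of_weights`:
* `sum_wt_indicator_supset`, `famIn_clauses_empty` (`famIn ∅ = 1 - ∑ φ = P(edge-core)`), `prod_weight_eq`;
* **`cover_edgeCore_bipartite`**: `Cover p (L ∪ R) (clauses Γ L R)` for every `IsBip Γ L R` with `P(edgeCore Γ) > 0`;
* **`gsafe_edgeCore_bipartite`**, **`safe_edgeCore_bipartite'`** (a certificate proof of g40's `Bridge.safe_edgeCore_of_bipartite`),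
  **`safe_edgeCore_bipartite_union`**: `Safe p (edgeCore Γ ∪ A₂)` for every safe up-set `A₂` of positive probability determined
  off `L ∪ R` — e.g. **`safe_edgeCore_bipartite_sup`**: the edge-core of `Γ ⊔ Γ'` for ANY A-safe graph `Γ'` on the other vertices.
-/

noncomputable section

namespace Summit.CriticalPhenomena.PercolationContinuityZ3.Theorems.SunflowerPartition

namespace BipCover

open Finset SafeCalc Grain Filter Topology
open MeasureTheory Literature.Probability.LatticeModels Literature.Probability.Percolation
open TwoGenCore (wmiss)

variable {ι : Type*} [Fintype ι] [DecidableEq ι] {Γ : SimpleGraph ι} [DecidableRel Γ.Adj] {L R : Finset ι}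
  (p : ι → unitInterval)

/-- The atom intensities `φ B = P(ω ∩ L = B) · ∏_{r ∈ nb B} (1 - p r)`. [this work] -/
def phiB : Atom L → ℝ := Grain.phi (mass L p) (qq p) (grain Γ L R) R

/-- The Möbius weight of a clause `C`: the product of `t_S[φ]` over the nonempty atom sets with joint neighbourhood `C ∩ R`.
[this work] -/
def weight (C : Finset ι) : ℝ :=
  ∏ S ∈ univ.filter (fun S : Finset (Atom L) => S.Nonempty ∧ nbU Γ L R S = C ∩ R), tR (phiB (Γ := Γ) (R := R) p) S

/-! ## Masses and intensities -/

omit [Fintype ι] in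
/-- Masses are nonnegative. [this work] -/
theorem mass_nonneg (B : Atom L) : 0 ≤ mass L p B := wmiss_nonneg p L _

omit [Fintype ι] in
/-- Masses sum to one. [this work] -/
theorem sum_mass : ∑ B : Atom L, mass L p B = 1 := by
  unfold mass
  rw [Finset.sum_coe_sort L.powerset (fun T => wmiss p L (L \ T)), ← sum_wmiss p L]
  exact Finset.sum_nbij' (fun T => L \ T) (fun T => L \ T) (fun T _ => mem_powerset.mpr sdiff_subset)
    (fun T _ => mem_powerset.mpr sdiff_subset) (fun T hT => Finset.sdiff_sdiff_eq_self (mem_powerset.mp hT))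
    (fun T hT => Finset.sdiff_sdiff_eq_self (mem_powerset.mp hT)) (fun T _ => rfl)

omit [Fintype ι] [DecidableEq ι] in
/-- `0 ≤ 1 - p r`. [this work] -/
theorem qq_nonneg (r : ι) : 0 ≤ qq p r := by unfold qq; linarith [(p r).2.2]

omit [Fintype ι] [DecidableEq ι] in
/-- `1 - p r ≤ 1`. [this work] -/
theorem qq_le_one (r : ι) : qq p r ≤ 1 := by unfold qq; linarith [(p r).2.1]

omit [Fintype ι] in
/-- The intensities are nonnegative. [this work] -/
theorem phiB_nonneg (B : Atom L) : 0 ≤ phiB (Γ := Γ) (R := R) p B :=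
  Grain.phi_nonneg (mass_nonneg p) (qq_nonneg p) R B

/-! ## `famIn ∅`, `∑ φ` and the full product of the weights -/

omit [Fintype ι] in
/-- `∑_{W ⊆ R} wt W · [D ⊆ W] = ∏_{r ∈ D} q r` for `D ⊆ R`. [this work] -/
theorem sum_wt_indicator_supset (q : ι → ℝ) (R : Finset ι) :
    ∀ D, D ⊆ R → ∑ W ∈ R.powerset, Grain.wt q R W * (if D ⊆ W then 1 else 0) = ∏ r ∈ D, q r := by
  induction R using Finset.induction_on with
  | empty =>
    intro D hD
    rw [subset_empty.mp hD]
    simp [Grain.wt]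
  | insert r R₀ hr ih =>
    intro D hD
    rw [sum_powerset_insert hr]
    by_cases hrD : r ∈ D
    · have hD' : D.erase r ⊆ R₀ := fun x hx => by
        have := hD (mem_of_mem_erase hx)
        rcases mem_insert.mp this with h | h
        · exact absurd h (ne_of_mem_erase hx)
        · exact h
      have h1 : ∑ W ∈ R₀.powerset, Grain.wt q (insert r R₀) W * (if D ⊆ W then 1 else 0) = 0 := by
        refine sum_eq_zero fun W hW => ?_
        rw [if_neg (fun h => hr (mem_powerset.mp hW (h hrD))), mul_zero]
      have h2 : ∑ W ∈ R₀.powerset, Grain.wt q (insert r R₀) (insert r W) * (if D ⊆ insert r W then 1 else 0) =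
          q r * ∑ W ∈ R₀.powerset, Grain.wt q R₀ W * (if D.erase r ⊆ W then 1 else 0) := by
        rw [mul_sum]
        refine sum_congr rfl fun W hW => ?_
        rw [Grain.wt_insert_insert R₀ W r hr (mem_powerset.mp hW)]
        have : D ⊆ insert r W ↔ D.erase r ⊆ W := by
          constructor
          · intro h x hx
            rw [mem_erase] at hx
            exact (mem_insert.mp (h hx.2)).resolve_left hx.1
          · intro h x hx
            by_cases hxr : x = r
            · exact hxr ▸ mem_insert_self r W
            · exact mem_insert_of_mem (h (mem_erase.mpr ⟨hxr, hx⟩))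
        simp only [this]
        ring
      rw [h1, h2, ih _ hD', zero_add, ← mul_prod_erase D q hrD]
    · have hD' : D ⊆ R₀ := fun x hx => by
        rcases mem_insert.mp (hD hx) with h | h
        · exact absurd (h ▸ hx) hrD
        · exact h
      have h1 : ∑ W ∈ R₀.powerset, Grain.wt q (insert r R₀) W * (if D ⊆ W then 1 else 0) =
          (1 - q r) * ∑ W ∈ R₀.powerset, Grain.wt q R₀ W * (if D ⊆ W then 1 else 0) := by
        rw [mul_sum]
        refine sum_congr rfl fun W hW => ?_
        rw [Grain.wt_insert_of_subset R₀ W r hr (mem_powerset.mp hW)]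
        ring
      have h2 : ∑ W ∈ R₀.powerset, Grain.wt q (insert r R₀) (insert r W) * (if D ⊆ insert r W then 1 else 0) =
          q r * ∑ W ∈ R₀.powerset, Grain.wt q R₀ W * (if D ⊆ W then 1 else 0) := by
        rw [mul_sum]
        refine sum_congr rfl fun W hW => ?_
        rw [Grain.wt_insert_insert R₀ W r hr (mem_powerset.mp hW)]
        have : D ⊆ insert r W ↔ D ⊆ W :=
          ⟨fun h x hx => (mem_insert.mp (h hx)).resolve_left (fun h' => hrD (h' ▸ hx)), fun h => h.trans (subset_insert r W)⟩
        simp only [this]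
        ring
      rw [h1, h2, ih _ hD']
      ring

/-- `famIn ∅ = 1 - ∑ φ`. [this work] -/
theorem famIn_clauses_empty (hb : IsBip Γ L R) :
    famIn p (L ∪ R) (clauses Γ L R) ∅ = 1 - ∑ B : Atom L, phiB (Γ := Γ) (R := R) p B := by
  rw [famIn_clauses_eq_G p hb ∅]
  unfold Grain.G phiB Grain.phi
  congr 1
  refine sum_congr rfl fun B _ => ?_
  congr 1
  unfold Grain.hit Grain.cov
  rw [grain, inter_eq_left.mpr (nb_subset _), ← sum_wt_indicator_supset (qq p) R (nb Γ R B.1) (nb_subset _)]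
  refine sum_congr rfl fun W _ => ?_
  congr 1
  have key : (∃ S ∈ rhat Γ L R ∅, B ∈ S ∧ ∀ j ∈ S, grain Γ L R j ∩ R ⊆ W) ↔ nb Γ R B.1 ⊆ W := by
    rw [cov_rhat_iff]
    constructor
    · rintro ⟨B', -, -, h1, h2⟩; exact h1.trans h2
    · intro h; exact ⟨B.1, B.2, notMem_empty _, Subset.refl _, h⟩
  by_cases h : nb Γ R B.1 ⊆ W
  · rw [if_pos h, if_pos (key.mpr h)]
  · rw [if_neg h, if_neg (fun h' => h (key.mp h'))]

/-- The edge-core probability: `famIn ∅ = P(edgeCore Γ)`. [this work] -/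
theorem famIn_clauses_empty_eq_real (hb : IsBip Γ L R) :
    famIn p (L ∪ R) (clauses Γ L R) ∅ = (prodBernoulli p).real (edgeCore Γ) := by
  refine famIn_empty p (L ∪ R) (determinedBy_edgeCore_of_adj Γ fun u v huv => ?_) (clauses Γ L R)
    (fun C hC T hT hCT hTA => ?_) (fun T hT hind => exists_clause_subset hb T hT hind)
  · rcases hb.adj u v huv with ⟨hu, hv⟩ | ⟨hu, hv⟩
    · exact ⟨Finset.mem_coe.mpr (mem_union_left R hu), Finset.mem_coe.mpr (mem_union_right L hv)⟩
    · exact ⟨Finset.mem_coe.mpr (mem_union_right L hu), Finset.mem_coe.mpr (mem_union_left R hv)⟩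
  · obtain ⟨B, -, rfl⟩ := mem_image.mp hC
    refine mset_not_mem_edgeCore hb (nb Γ R B) (isUpperSet_edgeCore Γ (Finset.coe_subset.mpr fun x hx => ?_) hTA)
    rw [← sdiff_clauseOf]
    exact mem_sdiff.mpr ⟨(mem_sdiff.mp hx).1, fun h => (mem_sdiff.mp hx).2 (hCT h)⟩

omit [Fintype ι] in
/-- `clauseOf B ∩ R = nb B`. [this work] -/
theorem clauseOf_inter (hb : IsBip Γ L R) (B : Finset ι) : clauseOf Γ L R B ∩ R = nb Γ R B := by
  ext r
  unfold clauseOf mset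
  constructor
  · intro hr
    obtain ⟨hrC, hrR⟩ := mem_inter.mp hr
    have hrC' := (mem_sdiff.mp hrC).2
    by_contra hnb
    exact hrC' (mem_union_right _ (mem_sdiff.mpr ⟨hrR, hnb⟩))
  · intro hr
    have hrR : r ∈ R := nb_subset _ hr
    refine mem_inter.mpr ⟨mem_sdiff.mpr ⟨mem_union_right _ hrR, fun hm => ?_⟩, hrR⟩
    rcases mem_union.mp hm with h | h
    · exact disjoint_left.mp hb.disj (mem_filter.mp h).1 hrR
    · exact (mem_sdiff.mp h).2 hr

omit [Fintype ι] in
/-- A clause is determined by its `R`-part. [this work] -/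
theorem clause_eq_of_inter_eq (hb : IsBip Γ L R) {C C' : Finset ι} (hC : C ∈ clauses Γ L R) (hC' : C' ∈ clauses Γ L R)
    (h : C ∩ R = C' ∩ R) : C = C' := by
  obtain ⟨B, -, rfl⟩ := mem_image.mp hC
  obtain ⟨B', -, rfl⟩ := mem_image.mp hC'
  rw [clauseOf_inter hb, clauseOf_inter hb] at h
  rw [clauseOf, clauseOf, h]

omit [Fintype ι] in
/-- The grain family of `𝒰` is the disjoint union, over the forbidden clauses, of the fibres of `weight`. [this work] -/
theorem FR_rhat_eq (hb : IsBip Γ L R) (𝒰 : Finset (Finset ι)) (φ : Atom L → ℝ) :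
    FR φ (rhat Γ L R 𝒰) = ∏ C ∈ clauses Γ L R \ 𝒰,
      ∏ S ∈ univ.filter (fun S : Finset (Atom L) => S.Nonempty ∧ nbU Γ L R S = C ∩ R), tR φ S := by
  rw [FR, ← prod_biUnion]
  · refine prod_congr ?_ fun _ _ => rfl
    ext S
    rw [rhat, mem_filter, mem_biUnion]
    constructor
    · rintro ⟨-, hne, B, hB, hC, hnb⟩
      refine ⟨clauseOf Γ L R B, mem_sdiff.mpr ⟨mem_image.mpr ⟨B, hB, rfl⟩, hC⟩, mem_filter.mpr ⟨mem_univ _, hne, ?_⟩⟩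
      rw [hnb, clauseOf_inter hb]
    · rintro ⟨C, hC, hS⟩
      obtain ⟨hCc, hCU⟩ := mem_sdiff.mp hC
      obtain ⟨-, hne, hnb⟩ := mem_filter.mp hS
      obtain ⟨B, hB, rfl⟩ := mem_image.mp hCc
      exact ⟨mem_univ _, hne, B, hB, hCU, by rw [hnb, clauseOf_inter hb]⟩
  · intro C hC C' hC' hne
    simp only [Function.onFun]
    rw [Finset.disjoint_left]
    intro S hS hS'
    rw [mem_filter] at hS hS'
    exact hne (clause_eq_of_inter_eq hb (mem_sdiff.mp hC).1 (mem_sdiff.mp hC').1 (hS.2.2.symm.trans hS'.2.2))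

/-- The full product of the weights is `1 - ∑ φ = famIn ∅`. [this work] -/
theorem prod_weight_eq (hb : IsBip Γ L R) (hφ1 : ∑ B : Atom L, phiB (Γ := Γ) (R := R) p B < 1) :
    ∏ C ∈ clauses Γ L R, weight (Γ := Γ) (L := L) (R := R) p C = famIn p (L ∪ R) (clauses Γ L R) ∅ := by
  have h := FR_rhat_eq hb ∅ (phiB (Γ := Γ) (R := R) p)
  rw [sdiff_empty] at h
  unfold weight
  rw [← h, famIn_clauses_empty p hb, ← prod_tR_powerset (phiB_nonneg p) hφ1 univ, FR, FR, powerset_univ]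
  -- `rhat ∅` = all nonempty atom sets; the empty set contributes `tR φ ∅ = 1`
  have hrhat : rhat Γ L R ∅ = univ.filter fun S : Finset (Atom L) => S.Nonempty := by
    ext S
    rw [rhat, mem_filter, mem_filter]
    constructor
    · rintro ⟨-, hne, -⟩; exact ⟨mem_univ _, hne⟩
    · rintro ⟨-, hne⟩
      refine ⟨mem_univ _, hne, S.sup (fun B => B.1), mem_powerset.mpr (Finset.sup_le fun B _ => mem_powerset.mp B.2),
        notMem_empty _, ?_⟩
      rw [nbU, nb_sup]
  rw [hrhat, ← prod_filter_mul_prod_filter_not univ (fun S : Finset (Atom L) => S.Nonempty)]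
  rw [prod_congr rfl (s₁ := univ.filter fun S : Finset (Atom L) => ¬ S.Nonempty) (g := fun _ => (1 : ℝ)) fun S hS => ?_]
  · rw [prod_const_one, mul_one]
  · rw [mem_filter, not_nonempty_iff_eq_empty] at hS
    rw [hS.2, tR]
    simp

/-! ## The certificate inequality: THEOREM 2 with masses `(1-ε)·mass`, then `ε → 0` -/

omit [Fintype ι] in
/-- Coverage probabilities are nonnegative. [this work] -/
theorem hit_nonneg (𝒱 : Finset (Finset (Atom L))) (B : Atom L) : 0 ≤ Grain.hit (qq p) (grain Γ L R) R 𝒱 B := by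
  unfold Grain.hit Grain.wt Grain.cov
  refine sum_nonneg fun W _ => mul_nonneg (mul_nonneg (prod_nonneg fun r _ => qq_nonneg p r)
    (prod_nonneg fun r _ => by linarith [qq_le_one p r])) ?_
  split_ifs <;> norm_num

/-- `famIn 𝒰 ≤ F_{rhat 𝒰}[(1-ε)·φ]` for `ε ∈ (0,1)` (THEOREM 2 for the masses `(1-ε)·mass`, which sum to `1-ε < 1`). [this work] -/
theorem famIn_le_FR_eps (hb : IsBip Γ L R) (𝒰 : Finset (Finset ι)) {ε : ℝ} (hε0 : 0 < ε) (hε1 : ε < 1) :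
    famIn p (L ∪ R) (clauses Γ L R) 𝒰 ≤ FR (fun B => (1 - ε) * phiB (Γ := Γ) (R := R) p B) (rhat Γ L R 𝒰) := by
  rw [famIn_clauses_eq_G p hb 𝒰]
  have hS : 0 ≤ ∑ i, mass L p i * Grain.hit (qq p) (grain Γ L R) R (rhat Γ L R 𝒰) i :=
    sum_nonneg fun i _ => mul_nonneg (mass_nonneg p i) (hit_nonneg p _ i)
  have hG : Grain.G (mass L p) (qq p) (grain Γ L R) R (rhat Γ L R 𝒰) ≤
      Grain.G (fun B => (1 - ε) * mass L p B) (qq p) (grain Γ L R) R (rhat Γ L R 𝒰) := by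
    unfold Grain.G
    have : ∑ i, (1 - ε) * mass L p i * Grain.hit (qq p) (grain Γ L R) R (rhat Γ L R 𝒰) i =
        (1 - ε) * ∑ i, mass L p i * Grain.hit (qq p) (grain Γ L R) R (rhat Γ L R 𝒰) i := by
      rw [mul_sum]; exact sum_congr rfl fun i _ => by ring
    rw [this]
    nlinarith
  refine hG.trans ?_
  have key := Grain.G_le_FR' (m := fun B => (1 - ε) * mass L p B) (q := qq p) (N := grain Γ L R)
    (fun i => mul_nonneg (by linarith) (mass_nonneg p i)) (by rw [← mul_sum, sum_mass]; linarith)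
    (qq_nonneg p) (qq_le_one p) R (rhat Γ L R 𝒰)
  have hphi : Grain.phi (fun B => (1 - ε) * mass L p B) (qq p) (grain Γ L R) R =
      fun B => (1 - ε) * phiB (Γ := Γ) (R := R) p B := by
    funext B; unfold phiB Grain.phi; ring
  rwa [hphi] at key

omit [Fintype ι] in
/-- `ε ↦ F_𝒱[(1-ε)φ]` is continuous at `0`. [this work] -/
theorem tendsto_FR_eps (φ : Atom L → ℝ) (hφ : ∀ B, 0 ≤ φ B) (h1 : ∑ B, φ B < 1) (𝒱 : Finset (Finset (Atom L))) :
    Tendsto (fun ε : ℝ => FR (fun B => (1 - ε) * φ B) 𝒱) (𝓝 0) (𝓝 (FR φ 𝒱)) := by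
  have hsub : Tendsto (fun ε : ℝ => (1 - ε)) (𝓝 0) (𝓝 1) := by
    have := (tendsto_const_nhds (x := (1 : ℝ))).sub (Filter.tendsto_id (x := 𝓝 (0 : ℝ)))
    rwa [sub_zero] at this
  have hB : ∀ Bs : Finset (Atom L),
      Tendsto (fun ε : ℝ => 1 - ∑ j ∈ Bs, (1 - ε) * φ j) (𝓝 0) (𝓝 (1 - ∑ j ∈ Bs, φ j)) := by
    intro Bs
    have h2 : Tendsto (fun ε : ℝ => ∑ j ∈ Bs, (1 - ε) * φ j) (𝓝 0) (𝓝 (∑ j ∈ Bs, 1 * φ j)) :=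
      tendsto_finsetSum Bs fun j _ => hsub.mul_const (φ j)
    simp only [one_mul] at h2
    exact tendsto_const_nhds.sub h2
  unfold FR tR
  refine tendsto_finsetProd 𝒱 fun S _ => ?_
  refine Tendsto.mul (tendsto_finsetProd _ fun Bs _ => hB Bs) (Tendsto.inv₀ (tendsto_finsetProd _ fun Bs _ => hB Bs) ?_)
  exact prod_ne_zero_iff.mpr fun Bs _ => by linarith [Grain.sum_lt_one_of_subset hφ h1 Bs]

/-- `∑ φ < 1` when the edge-core has positive probability. [this work] -/
theorem sum_phiB_lt_one (hb : IsBip Γ L R) (hpos : 0 < (prodBernoulli p).real (edgeCore Γ)) :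
    ∑ B : Atom L, phiB (Γ := Γ) (R := R) p B < 1 := by
  have h := famIn_clauses_empty p hb
  rw [famIn_clauses_empty_eq_real p hb] at h
  linarith

/-- **THE MÖBIUS CERTIFICATE IS A CORE POINT**: `famIn 𝒰 ≤ ∏_{C ∈ clauses ∖ 𝒰} weight C` for every `𝒰`. [this work] -/
theorem famIn_le_prod_weight (hb : IsBip Γ L R) (hpos : 0 < (prodBernoulli p).real (edgeCore Γ)) (𝒰 : Finset (Finset ι)) :
    famIn p (L ∪ R) (clauses Γ L R) 𝒰 ≤ ∏ C ∈ clauses Γ L R \ 𝒰, weight (Γ := Γ) (L := L) (R := R) p C := by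
  have hφ1 := sum_phiB_lt_one p hb hpos
  unfold weight
  rw [← FR_rhat_eq hb 𝒰]
  have ht : Tendsto (fun ε : ℝ => FR (fun B => (1 - ε) * phiB (Γ := Γ) (R := R) p B) (rhat Γ L R 𝒰))
      (𝓝[>] 0) (𝓝 (FR (phiB (Γ := Γ) (R := R) p) (rhat Γ L R 𝒰))) :=
    tendsto_nhdsWithin_of_tendsto_nhds (tendsto_FR_eps _ (phiB_nonneg (L := L) p) hφ1 _)
  refine ge_of_tendsto ht ?_
  filter_upwards [Ioo_mem_nhdsGT (zero_lt_one' ℝ)] with ε hε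
  exact famIn_le_FR_eps p hb 𝒰 hε.1 hε.2

/-! ## COVER, graded safety, safety, disjunction with safe cores -/

omit [Fintype ι] [DecidableRel Γ.Adj] in
/-- The edge-core of a bipartite graph is determined by `L ∪ R`. [this work] -/
theorem determinedBy_edgeCore_bip (hb : IsBip Γ L R) : DeterminedBy (edgeCore Γ) (↑(L ∪ R) : Set ι) := by
  refine determinedBy_edgeCore_of_adj Γ fun u v huv => ?_
  rcases hb.adj u v huv with ⟨hu, hv⟩ | ⟨hu, hv⟩
  · exact ⟨Finset.mem_coe.mpr (mem_union_left R hu), Finset.mem_coe.mpr (mem_union_right L hv)⟩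
  · exact ⟨Finset.mem_coe.mpr (mem_union_right L hu), Finset.mem_coe.mpr (mem_union_left R hv)⟩

/-- **BAL-bip / COVER (memo THEOREM 3).**  For every graph `Γ` bipartite with respect to `(L, R)` and every `p` with
`P(edgeCore Γ) > 0`, the clause family of `Γ` has the COVER property on `L ∪ R` — the Möbius certificate is a point of the
core of the cost game `-log famIn`. [this work] -/
theorem cover_edgeCore_bipartite (hb : IsBip Γ L R) (hpos : 0 < (prodBernoulli p).real (edgeCore Γ)) :
    Cover p (L ∪ R) (clauses Γ L R) := by
  have hφ1 := sum_phiB_lt_one p hb hpos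
  have hφ0 := phiB_nonneg (Γ := Γ) (L := L) (R := R) p
  refine cover_of_weights p (L ∪ R) (clauses Γ L R) (weight (Γ := Γ) (L := L) (R := R) p)
    (fun C _ => prod_nonneg fun S _ => (tR_pos hφ0 hφ1 S).le)
    (fun C _ => prod_le_one (fun S _ => (tR_pos hφ0 hφ1 S).le) fun S _ => tR_le_one hφ0 hφ1 S) ?_ ?_
  · rw [prod_weight_eq p hb hφ1]
  · intro 𝒰 _
    exact famIn_le_prod_weight p hb hpos 𝒰

/-- **Every bipartite graph core is GRADEDLY SAFE.** [this work] -/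
theorem gsafe_edgeCore_bipartite (hb : IsBip Γ L R) (hpos : 0 < (prodBernoulli p).real (edgeCore Γ)) :
    GSafe p (L ∪ R) (edgeCore Γ) := by
  refine gsafe_of_cover p (L ∪ R) (determinedBy_edgeCore_bip hb) (isUpperSet_edgeCore Γ) hpos (clauses Γ L R)
    (fun C hC => ?_) (fun C hC => ?_) (fun T hT hind => exists_clause_subset hb T hT hind)
    (cover_edgeCore_bipartite p hb hpos)
  · obtain ⟨B, -, rfl⟩ := mem_image.mp hC
    exact sdiff_subset
  · obtain ⟨B, -, rfl⟩ := mem_image.mp hC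
    rw [sdiff_clauseOf]
    exact mset_not_mem_edgeCore hb _

/-- **Every bipartite graph core is SAFE** (Lemma A for all numbers of petals; a certificate proof of g40's
`Bridge.safe_edgeCore_of_bipartite`). [this work] -/
theorem safe_edgeCore_bipartite' (hb : IsBip Γ L R) (hpos : 0 < (prodBernoulli p).real (edgeCore Γ)) :
    Safe p (edgeCore Γ) :=
  safe_of_gsafe p (L ∪ R) (determinedBy_edgeCore_bip hb) (isUpperSet_edgeCore Γ) (gsafe_edgeCore_bipartite p hb hpos)

/-- **Safe(bipartite ∪ safe)**: the union of a bipartite graph core with any safe up-set of positive probability determined off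
`L ∪ R` is safe. [this work] -/
theorem safe_edgeCore_bipartite_union (hb : IsBip Γ L R) (hpos : 0 < (prodBernoulli p).real (edgeCore Γ))
    {A₂ : Set (Set ι)} (hd₂ : DeterminedBy A₂ (↑(L ∪ R) : Set ι)ᶜ) (hu₂ : IsUpperSet A₂)
    (hpos₂ : 0 < (prodBernoulli p).real A₂) (h₂ : Safe p A₂) : Safe p (edgeCore Γ ∪ A₂) :=
  safe_union_of_gsafe p (L ∪ R) (determinedBy_edgeCore_bip hb) hd₂ (isUpperSet_edgeCore Γ) hu₂ hpos₂
    (gsafe_edgeCore_bipartite p hb hpos) h₂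

/-- **`Γ ⊔ Γ'` is A-safe for every bipartite `Γ` and every A-safe graph `Γ'` on the other vertices.** [this work] -/
theorem safe_edgeCore_bipartite_sup (hb : IsBip Γ L R) (hpos : 0 < (prodBernoulli p).real (edgeCore Γ))
    (Γ' : SimpleGraph ι) (hΓ' : ∀ u v, Γ'.Adj u v → u ∉ L ∪ R ∧ v ∉ L ∪ R)
    (hpos' : 0 < (prodBernoulli p).real (edgeCore Γ')) (hsafe : Safe p (edgeCore Γ')) : Safe p (edgeCore (Γ ⊔ Γ')) := by
  rw [edgeCore_sup]
  refine safe_edgeCore_bipartite_union p hb hpos (determinedBy_edgeCore_of_adj Γ' fun u v huv => ?_)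
    (isUpperSet_edgeCore Γ') hpos' hsafe
  obtain ⟨hu, hv⟩ := hΓ' u v huv
  exact ⟨fun h => hu (Finset.mem_coe.mp h), fun h => hv (Finset.mem_coe.mp h)⟩

/-- **g40's theorem, second (certificate) proof**: if every edge of `Γ` crosses between `L` and its complement, the edge-core of `Γ`
is SAFE for every `p` (the case `P(edgeCore Γ) = 0` being `safe_of_real_eq_zero`). [this work] -/
theorem safe_edgeCore_of_crossing (Γ : SimpleGraph ι) [DecidableRel Γ.Adj] (L : Finset ι)
    (hL : ∀ u v, Γ.Adj u v → (u ∈ L ↔ v ∉ L)) : Safe p (edgeCore Γ) := by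
  have hb : IsBip Γ L (univ \ L) := ⟨disjoint_sdiff, fun u v huv => by
    by_cases hu : u ∈ L
    · exact Or.inl ⟨hu, mem_sdiff.mpr ⟨mem_univ v, (hL u v huv).mp hu⟩⟩
    · have hv : v ∈ L := by
        by_contra hv
        exact hu ((hL u v huv).mpr hv)
      exact Or.inr ⟨mem_sdiff.mpr ⟨mem_univ u, hu⟩, hv⟩⟩
  by_cases hpos : 0 < (prodBernoulli p).real (edgeCore Γ)
  · exact safe_edgeCore_bipartite' p hb hpos
  · exact safe_of_real_eq_zero p (le_antisymm (not_lt.mp hpos) measureReal_nonneg)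

end BipCover

end Summit.CriticalPhenomena.PercolationContinuityZ3.Theorems.SunflowerPartition
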